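import Mathlib
import HarnessLib
import Summits.HubbardSuperconductivity.HubbardSuperconductivity.Theorems.KLProgrammeKLRegimeVolumeLimitLastScaleUnits
import Summits.HubbardSuperconductivity.HubbardSuperconductivity.Theorems.KLProgrammeKLRegimeTwoVolumeDualReadoutRows
import Summits.HubbardSuperconductivity.HubbardSuperconductivity.Theorems.KLProgrammeKLRegimeTwoVolumeDualMomentumReadout
import Summits.HubbardSuperconductivity.HubbardSuperconductivity.Theses.KLProgramme

/-!
# Route `KLProgramme` — crux K3, VL child `KLRegimeVolumeLimitV17F2` (stmt-HubbardSuperconductivity-20440): THE STUB TEXT FROM THE ROWS OF THE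
# DIAGONALLY DRESSED LAST-SCALE ACTIONS `S_c T_V` — the (R-src) read-out END TO END (instance of `…LastScaleWeightedDualDoor`)
# (cell gate-hubbard-kl, seat hubbard-kl-k3c5-p3 g10, technique «OS-positivity-free direct assembly»; located risk #8, repair (R-src))

The dressed last-scale action of (R-src) is, on its source legs, the one-shot action composed with a DIAGONAL dressing of the generators:
`S_c T_V := ExteriorAlgebra.map (LinearMap.mulLeft ℂ c_V) (klEffectiveAction V … K_L klE0 n⋆)` (dressing `c(ω,k,±)`, e.g. the covariance symbol).  Its `(+,−)`
two-leg kernel is diagonal with `T_V`'s (`kernel_two_offDiag_klEffectiveAction` — the model's action conserves momentum, k3c5-p2's conservation laws — and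
`kernel_two_offDiag_map_mulLeft`), and its self-energy string is `c₊c₋·Σ^{K_L}_V` (`selfEnergy_map_mulLeft`, [tree] `kernel_map_mulLeft`); so the weighted dual
read-out (p563659 `…LastScaleWeightedDualDoor`, here re-derived inline so that this leaf builds on NO Theses-importing Theorems module — route-cone hygiene)
applies with `w k := c₊(ω,k)·c₋(ω,k)`:

* **`framedNestedFlowTextV17F2_of_dressedLastScaleRows`** — the registered stub text from «per Matsubara integer `∃ L₀ δ→0 B w₀>0`: for `L ≥ L₀`, `L″ = b·L`,
  eventually in `M`, `∃` dressings `c_L, c_{L″}` and a weight `w` with `w₀ ≤ ‖w k‖`, `c_L(ω,k,+)c_L(ω,k,−) = w k`, `c_{L″}(ω,k″,+)c_{L″}(ω,k″,−) = w k` at `p_{k″} = p_k`,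
  pins `o_c, o_f`: `2ε·(Ddef₊ + Dfar₊)(S_{c_L}T_L, S_{c_{L″}}T_{L″}) ≤ δ L` and `2ε·Σ_y‖R_{S_{c_L}T_L}(o_c;y)‖ ≤ B`» — NOTHING ELSE;
* the by-workitem closer **`KLRegimeVolumeLimitV17F2_of_dressedLastScaleRows`**.

What the (A3)-augmented author then owes for 20440: the identification of the chain's last object with `S_{c_V} T_V` on the source legs (exact algebra:
`effAction_spectator_map_of_copyZero_rows` / k3c4-p1's `effAction_blockZero_map_eq` scale by scale) and the pinned two-volume defect `→ 0`.  Proofs only; no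
definition.  References: BGM 2006 §2.9 (4.10a)–(4.15), §2.4 (2.38).
-/

noncomputable section


namespace Summit.HubbardSuperconductivity.HubbardSuperconductivity.Theorems.TwoVolumeDefect

set_option linter.dupNamespace false -- summit = problem name (single-conjunct summit), D-0017

open Finset Complex Literature.MathematicalPhysics.QuantumLattice Literature.Probability.LatticeModels GrassmannAlgebra
open Summit.HubbardSuperconductivity.HubbardSuperconductivity.Theorems.KLRegimeSplit
open Summit.HubbardSuperconductivity.HubbardSuperconductivity.Theorems.KLProgrammeLegKernels
open Summit.HubbardSuperconductivity.HubbardSuperconductivity.Theorems.KLRegimeWick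

section Dressing

variable {L M : ℕ} [NeZero L] [NeZero M]

/-- **The model's action has a DIAGONAL `(+,−)` two-leg momentum kernel at every scale and frame** (the separated data do — k3c5-p2's
`kernel_two_offDiag_klEffectiveAction_sub_counter` — and so does the counter-quadratic). [cite: BenfattoGiulianiMastropietro2006, §2.3 (2.17)] -/
theorem kernel_two_offDiag_klEffectiveAction (β U μ : ℝ) (K : TrigPolyC4v) (n : ℕ) (σ : Fin 2) (k k' : FreqMomentum L M) (hk : k' ≠ k) :
    kernel ℂ (klEffectiveAction L M β U μ K klE0 n) 2 ![((k, σ), 0), ((k', σ), 1)] = 0 := by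
  have h := kernel_two_offDiag_klEffectiveAction_sub_counter (L := L) (M := M) β U μ K n σ k k' hk
  rwa [TwoLegFourier.kernel_sub', kernel_counterQuadratic_two_offDiag β K σ hk, sub_zero] at h

omit [NeZero L] [NeZero M] in
/-- **A diagonal dressing keeps the two-leg kernel diagonal**: `kernel (S_c G) 2 = (c·c)·kernel G 2`. [folklore] -/
theorem kernel_two_offDiag_map_mulLeft (c : HubbardFieldIdx L M → ℂ) (G : HubbardGrassmann L M) (σ : Fin 2)
    (hG : ∀ k k' : FreqMomentum L M, k' ≠ k → kernel ℂ G 2 ![((k, σ), 0), ((k', σ), 1)] = 0) (k k' : FreqMomentum L M) (hk : k' ≠ k) :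
    kernel ℂ (ExteriorAlgebra.map (LinearMap.mulLeft ℂ c) G) 2 ![((k, σ), 0), ((k', σ), 1)] = 0 := by
  rw [kernel_map_mulLeft, hG k k' hk, mul_zero]

omit [NeZero L] [NeZero M] in
/-- **The self-energy string of a diagonally dressed element**: `Σ_{S_c G}(K,σ) = c(K,σ,+)·c(K,σ,−)·Σ_G(K,σ)`. [folklore] -/
theorem selfEnergy_map_mulLeft (β : ℝ) (c : HubbardFieldIdx L M → ℂ) (G : HubbardGrassmann L M) (K : FreqMomentum L M) (σ : Fin 2) :
    selfEnergy L M β (ExteriorAlgebra.map (LinearMap.mulLeft ℂ c) G) K σ = c ((K, σ), 0) * c ((K, σ), 1) * selfEnergy L M β G K σ := by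
  rw [TwoLegFourier.selfEnergy_eq_vertexFn, TwoLegFourier.selfEnergy_eq_vertexFn, kernel_map_mulLeft, Fin.prod_univ_two]
  simp only [Matrix.cons_val_zero, Matrix.cons_val_one]
  ring

end Dressing

end Summit.HubbardSuperconductivity.HubbardSuperconductivity.Theorems.TwoVolumeDefect

namespace Summit.HubbardSuperconductivity.HubbardSuperconductivity.Theorems.TwoPointAssembly

set_option linter.dupNamespace false -- summit = problem name (single-conjunct summit), D-0017

open Finset Filter Topology Complex Literature.MathematicalPhysics.QuantumLattice Literature.Probability.LatticeModels GrassmannAlgebra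
open Summit.HubbardSuperconductivity.HubbardSuperconductivity.Theorems.KLRegimeSplit
open Summit.HubbardSuperconductivity.HubbardSuperconductivity.Theorems.KLProgrammeLegKernels
open Summit.HubbardSuperconductivity.HubbardSuperconductivity.Theorems.TwoVolumeDefect

/-- **THE STUB TEXT FROM THE ROWS OF THE DIAGONALLY DRESSED LAST-SCALE ACTIONS** `S_{c_V} T_V(K_L)` (the (R-src) read-out, end to end): per Matsubara
integer `∃ L₀ δ→0 B w₀>0`: for `L ≥ L₀`, `L″ = b·L`, eventually in `M`, `∃` dressings `c_L, c_{L″}` and a weight `w` with `w₀ ≤ ‖w k‖`,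
`c_L(ω,k,+)·c_L(ω,k,−) = w k`, `c_{L″}(ω,k″,+)·c_{L″}(ω,k″,−) = w k` at `p_{k″} = p_k`, pins `o_c, o_f`: `2ε·(Ddef₊ + Dfar₊)(S_{c_L}T_L, S_{c_{L″}}T_{L″}) ≤ δ L`
and `2ε·Σ_y‖R_{S_{c_L}T_L}(o_c;y)‖ ≤ B` — NOTHING ELSE. [cite: BenfattoGiulianiMastropietro2006, §2.9 (4.10a)-(4.15)] -/
theorem framedNestedFlowTextV17F2_of_dressedLastScaleRows
    (hS : ∀ (G : GeoConsts) (P : SplitConsts) (Q : EngConsts) (R : RenConsts), G.WF → P.WF → Q.WF → R.WF →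
      ∃ c₅ : ℝ, 0 < c₅ ∧ ∀ c : ℝ, 0 < c → c ≤ c₅ → ∃ U₀ : ℝ, 0 < U₀ ∧
        ∀ μ ∈ klWindowC, ∀ U : ℝ, 0 < U → U ≤ U₀ → ∀ β : ℝ, klBetaMin ≤ β → β ≤ Real.exp (c / U ^ 2) →
          ∀ K : TrigPolyC4v, klPredsV17F2.frameOK R U (nScales β) μ K →
            ∀ (Lstar : ℕ) (Mstar : ℕ → ℕ), TowerP klPredsV17F2 G P Q R β U μ K Lstar Mstar →
              ∀ n : ℤ, ∃ L₀ : ℕ, ∃ δ : ℕ → ℝ, ∃ B w₀ : ℝ, 0 < w₀ ∧ Tendsto δ atTop (𝓝 0) ∧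
                ∀ (L : ℕ) [NeZero L], L₀ ≤ L → ∀ (L'' : ℕ) [NeZero L''] (b : ℕ), L'' = b * L → ∃ M₀ : ℕ, ∀ (M : ℕ) [NeZero M], M₀ ≤ M →
                  ∃ (cc : HubbardFieldIdx L M → ℂ) (cf : HubbardFieldIdx L'' M → ℂ) (w : TorusSite 2 L → ℂ)
                    (oc : SpaceTimeIdx L M) (of : SpaceTimeIdx L'' M),
                    ∀ ω : MatsubaraIdx M, matsubaraInt M ω = n →
                      (∀ k : TorusSite 2 L, w₀ ≤ ‖w k‖ ∧ cc (((ω, k), 0), 0) * cc (((ω, k), 0), 1) = w k) ∧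
                      (∀ (k : TorusSite 2 L) (k'' : TorusSite 2 L''), latticeMomentum L'' k'' = latticeMomentum L k →
                        cf (((ω, k''), 0), 0) * cf (((ω, k''), 0), 1) = w k) ∧
                      2 * imagTimeWeight β M *
                        ((∑ ybar : TorusSite 2 L,
                            ‖(∑ t₁ : ImagTimeIdx M,
                                sectorisedKernel L M β (trivialMultiplier L M)
                                    (ExteriorAlgebra.map (LinearMap.mulLeft ℂ cc)
                                      (klEffectiveAction L M β U μ (klFlowFrameU L M β U μ (nScales β + 1)) klE0 (nScales β + 1))) 2
                                    (![((0, 0), 0), ((0, 0), 1)] : Fin 2 → SectorLeg 1) ![oc, (t₁, oc.2 + ybar)] *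
                                  Complex.exp (((matsubaraFreq β M ω * (imagTime β M oc.1 - imagTime β M t₁) : ℝ) : ℂ) * I)) -
                              (∑ t₁ : ImagTimeIdx M,
                                sectorisedKernel L'' M β (trivialMultiplier L'' M)
                                    (ExteriorAlgebra.map (LinearMap.mulLeft ℂ cf)
                                      (klEffectiveAction L'' M β U μ (klFlowFrameU L M β U μ (nScales β + 1)) klE0 (nScales β + 1))) 2
                                    (![((0, 0), 0), ((0, 0), 1)] : Fin 2 → SectorLeg 1) ![of, (t₁, of.2 + Torus.proj L'' (Torus.cRep ybar))] *
                                  Complex.exp (((matsubaraFreq β M ω * (imagTime β M of.1 - imagTime β M t₁) : ℝ) : ℂ) * I))‖) +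
                          ∑ y ∈ univ.filter (fun y : TorusSite 2 L'' => Torus.proj L'' (Torus.cRep (fun i => (((y i).val : ℕ) : ZMod L))) ≠ y),
                            ‖∑ t₁ : ImagTimeIdx M,
                                sectorisedKernel L'' M β (trivialMultiplier L'' M)
                                    (ExteriorAlgebra.map (LinearMap.mulLeft ℂ cf)
                                      (klEffectiveAction L'' M β U μ (klFlowFrameU L M β U μ (nScales β + 1)) klE0 (nScales β + 1))) 2
                                    (![((0, 0), 0), ((0, 0), 1)] : Fin 2 → SectorLeg 1) ![of, (t₁, of.2 + y)] *
                                  Complex.exp (((matsubaraFreq β M ω * (imagTime β M of.1 - imagTime β M t₁) : ℝ) : ℂ) * I)‖) ≤ δ L ∧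
                      2 * imagTimeWeight β M * ∑ y : TorusSite 2 L,
                        ‖∑ t₁ : ImagTimeIdx M,
                            sectorisedKernel L M β (trivialMultiplier L M)
                                (ExteriorAlgebra.map (LinearMap.mulLeft ℂ cc)
                                  (klEffectiveAction L M β U μ (klFlowFrameU L M β U μ (nScales β + 1)) klE0 (nScales β + 1))) 2
                                (![((0, 0), 0), ((0, 0), 1)] : Fin 2 → SectorLeg 1) ![oc, (t₁, oc.2 + y)] *
                              Complex.exp (((matsubaraFreq β M ω * (imagTime β M oc.1 - imagTime β M t₁) : ℝ) : ℂ) * I)‖ ≤ B) :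
    ∀ (G : GeoConsts) (P : SplitConsts) (Q : EngConsts) (R : RenConsts), G.WF → P.WF → Q.WF → R.WF →
      ∃ c₅ : ℝ, 0 < c₅ ∧ ∀ c : ℝ, 0 < c → c ≤ c₅ → ∃ U₀ : ℝ, 0 < U₀ ∧
        ∀ μ ∈ klWindowC, ∀ U : ℝ, 0 < U → U ≤ U₀ → ∀ β : ℝ, klBetaMin ≤ β → β ≤ Real.exp (c / U ^ 2) →
          ∀ K : TrigPolyC4v, klPredsV17F2.frameOK R U (nScales β) μ K →
            ∀ (Lstar : ℕ) (Mstar : ℕ → ℕ), TowerP klPredsV17F2 G P Q R β U μ K Lstar Mstar →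
              ∀ n : ℤ, ∃ L₀ : ℕ, ∃ ρ : ℕ → ℝ, Tendsto ρ atTop (𝓝 0) ∧
                ∀ (L : ℕ) [NeZero L], L₀ ≤ L → ∀ (L'' : ℕ) [NeZero L''], L ∣ L'' → ∃ M₀ : ℕ, ∀ (M : ℕ) [NeZero M], M₀ ≤ M →
                  ∀ (ω : MatsubaraIdx M), matsubaraInt M ω = n → ∀ (k : TorusSite 2 L) (k'' : TorusSite 2 L''),
                    latticeMomentum L'' k'' = latticeMomentum L k →
                      ‖klSelfEnergy L M β U μ (klFlowFrameU L M β U μ (nScales β + 1)) klE0 (nScales β + 1) (ω, k) 0 -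
                          klSelfEnergy L'' M β U μ (klFlowFrameU L'' M β U μ (nScales β + 1)) klE0 (nScales β + 1) (ω, k'') 0‖ ≤ ρ L := by
  refine framedNestedFlowTextV17F2_of_commonFrame_bounded ?_
  intro G P Q R hG hP hQ hR
  obtain ⟨c₅, hc₅, hc⟩ := hS G P Q R hG hP hQ hR
  refine ⟨c₅, hc₅, fun c hc0 hcc => ?_⟩
  obtain ⟨U₀, hU₀, hU⟩ := hc c hc0 hcc
  refine ⟨U₀, hU₀, fun μ hμ U hU0 hUU β hβmin hβmax K hK Lstar Mstar hT n => ?_⟩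
  have hβ : 0 < β := pos_of_klBetaMin_le hβmin
  obtain ⟨L₀, δ, B, w₀, hw₀, hδ, hSn⟩ := hU μ hμ U hU0 hUU β hβmin hβmax K hK Lstar Mstar hT n
  refine ⟨max L₀ 3, fun L => w₀⁻¹ * δ L, w₀⁻¹ * B, by simpa using hδ.const_mul w₀⁻¹, fun L _ hL L'' _ hdvd => ?_⟩
  obtain ⟨b, hb⟩ := hdvd
  have hb' : L'' = b * L := by rw [hb, mul_comm]
  have hL₀ : L₀ ≤ L := (le_max_left _ _).trans hL
  have hL3 : 3 ≤ L := (le_max_right _ _).trans hL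
  have hL'' : 3 ≤ L'' := hL3.trans (Nat.le_of_dvd (Nat.pos_of_ne_zero (NeZero.ne L'')) ⟨b, hb⟩)
  obtain ⟨M₀, hM₀⟩ := hSn L hL₀ L'' b hb'
  obtain ⟨M₁, hM₁⟩ := isUnit_effPartitionFn_lastScale_eventually (L := L'') hβ U μ hL''
  refine ⟨max M₀ M₁, fun M _ hM ω hω k k'' hk => ?_⟩
  have hMM₀ : M₀ ≤ M := (le_max_left _ _).trans hM
  have hMM₁ : M₁ ≤ M := (le_max_right _ _).trans hM
  obtain ⟨cc, cf, w, oc, of, hlab⟩ := hM₀ M hMM₀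
  obtain ⟨hwc, hwf, hdef, hB⟩ := hlab ω hω
  -- notation: the two dressed actions and their diagonal two-leg kernels
  set Kc : TrigPolyC4v := klFlowFrameU L M β U μ (nScales β + 1) with hKc
  set Gc : HubbardGrassmann L M := ExteriorAlgebra.map (LinearMap.mulLeft ℂ cc) (klEffectiveAction L M β U μ Kc klE0 (nScales β + 1)) with hGc
  set Gf : HubbardGrassmann L'' M := ExteriorAlgebra.map (LinearMap.mulLeft ℂ cf) (klEffectiveAction L'' M β U μ Kc klE0 (nScales β + 1)) with hGf
  have hdc : ∀ q q' : FreqMomentum L M, q' ≠ q → kernel ℂ Gc 2 ![((q, 0), 0), ((q', 0), 1)] = 0 :=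
    kernel_two_offDiag_map_mulLeft cc _ 0 (kernel_two_offDiag_klEffectiveAction β U μ Kc _ 0)
  have hdf : ∀ q q' : FreqMomentum L'' M, q' ≠ q → kernel ℂ Gf 2 ![((q, 0), 0), ((q', 0), 1)] = 0 :=
    kernel_two_offDiag_map_mulLeft cf _ 0 (kernel_two_offDiag_klEffectiveAction β U μ Kc _ 0)
  have hwk : w₀ ≤ ‖w k‖ := (hwc k).1
  have hwk0 : w k ≠ 0 := fun h => by rw [h, norm_zero] at hwk; exact absurd hwk (not_le.2 hw₀)
  have hwpos : 0 < ‖w k‖ := norm_pos_iff.2 hwk0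
  have hinv : ‖w k‖⁻¹ ≤ w₀⁻¹ := by rw [inv_le_inv₀ hwpos hw₀]; exact hwk
  have hε : 0 ≤ 2 * imagTimeWeight β M := by have := imagTimeWeight_nonneg hβ.le M; positivity
  -- the self-energy strings of the dressed actions are `w k · Σ^{K_L}`
  have hreadc : selfEnergy L M β Gc (ω, k) 0 = w k * klSelfEnergy L M β U μ Kc klE0 (nScales β + 1) (ω, k) 0 := by
    rw [hGc, selfEnergy_map_mulLeft, (hwc k).2]; rfl
  have hreadf : selfEnergy L'' M β Gf (ω, k'') 0 = w k * klSelfEnergy L'' M β U μ Kc klE0 (nScales β + 1) (ω, k'') 0 := by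
    rw [hGf, selfEnergy_map_mulLeft, hwf k k'' hk]; rfl
  refine ⟨hM₁ M hMM₁ _, ?_, ?_⟩
  · -- leg (i): dual read-out of the dressed pair, weight divided out
    have hi := norm_selfEnergy_sub_le_dualDefect_of_latticeMomentum_eq hb' hβ Gc Gf ω 0
      (fun x₀ x₀' z => by rw [row_eq_of_diagonal hβ.ne' Gc ω 0 hdc x₀ z, row_eq_of_diagonal hβ.ne' Gc ω 0 hdc x₀' z])
      (fun x₀ x₀' z => by rw [row_eq_of_diagonal hβ.ne' Gf ω 0 hdf x₀ z, row_eq_of_diagonal hβ.ne' Gf ω 0 hdf x₀' z]) oc of hk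
    rw [hreadc, hreadf, ← mul_sub, norm_mul] at hi
    have hdef' := hi.trans hdef
    have hdef0 : 0 ≤ δ L := le_trans (mul_nonneg (norm_nonneg _) (norm_nonneg _)) hdef'
    calc ‖klSelfEnergy L M β U μ Kc klE0 (nScales β + 1) (ω, k) 0 - klSelfEnergy L'' M β U μ Kc klE0 (nScales β + 1) (ω, k'') 0‖
        = ‖w k‖⁻¹ * (‖w k‖ * ‖klSelfEnergy L M β U μ Kc klE0 (nScales β + 1) (ω, k) 0 -
            klSelfEnergy L'' M β U μ Kc klE0 (nScales β + 1) (ω, k'') 0‖) := by field_simp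
      _ ≤ ‖w k‖⁻¹ * δ L := mul_le_mul_of_nonneg_left hdef' (inv_nonneg.2 hwpos.le)
      _ ≤ w₀⁻¹ * δ L := mul_le_mul_of_nonneg_right hinv hdef0
  · -- the one-volume bound
    have hi := norm_selfEnergy_le_dualRows hβ Gc ω 0
      (fun x₀ x₀' z => by rw [row_eq_of_diagonal hβ.ne' Gc ω 0 hdc x₀ z, row_eq_of_diagonal hβ.ne' Gc ω 0 hdc x₀' z]) oc k
    rw [hreadc, norm_mul] at hi
    have hB' := hi.trans hB
    have hB0 : 0 ≤ B := le_trans (mul_nonneg (norm_nonneg _) (norm_nonneg _)) hB'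
    calc ‖klSelfEnergy L M β U μ Kc klE0 (nScales β + 1) (ω, k) 0‖
        = ‖w k‖⁻¹ * (‖w k‖ * ‖klSelfEnergy L M β U μ Kc klE0 (nScales β + 1) (ω, k) 0‖) := by field_simp
      _ ≤ ‖w k‖⁻¹ * B := mul_le_mul_of_nonneg_left hB' (inv_nonneg.2 hwpos.le)
      _ ≤ w₀⁻¹ * B := mul_le_mul_of_nonneg_right hinv hB0

/-- **By-workitem closer from the dressed last-scale rows.** [cite: BenfattoGiulianiMastropietro2006, §2.9 (4.10a)-(4.15)] -/
theorem KLRegimeVolumeLimitV17F2_of_dressedLastScaleRows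
    (hS : ∀ (G : GeoConsts) (P : SplitConsts) (Q : EngConsts) (R : RenConsts), G.WF → P.WF → Q.WF → R.WF →
      ∃ c₅ : ℝ, 0 < c₅ ∧ ∀ c : ℝ, 0 < c → c ≤ c₅ → ∃ U₀ : ℝ, 0 < U₀ ∧
        ∀ μ ∈ klWindowC, ∀ U : ℝ, 0 < U → U ≤ U₀ → ∀ β : ℝ, klBetaMin ≤ β → β ≤ Real.exp (c / U ^ 2) →
          ∀ K : TrigPolyC4v, klPredsV17F2.frameOK R U (nScales β) μ K →
            ∀ (Lstar : ℕ) (Mstar : ℕ → ℕ), TowerP klPredsV17F2 G P Q R β U μ K Lstar Mstar →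
              ∀ n : ℤ, ∃ L₀ : ℕ, ∃ δ : ℕ → ℝ, ∃ B w₀ : ℝ, 0 < w₀ ∧ Tendsto δ atTop (𝓝 0) ∧
                ∀ (L : ℕ) [NeZero L], L₀ ≤ L → ∀ (L'' : ℕ) [NeZero L''] (b : ℕ), L'' = b * L → ∃ M₀ : ℕ, ∀ (M : ℕ) [NeZero M], M₀ ≤ M →
                  ∃ (cc : HubbardFieldIdx L M → ℂ) (cf : HubbardFieldIdx L'' M → ℂ) (w : TorusSite 2 L → ℂ)
                    (oc : SpaceTimeIdx L M) (of : SpaceTimeIdx L'' M),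
                    ∀ ω : MatsubaraIdx M, matsubaraInt M ω = n →
                      (∀ k : TorusSite 2 L, w₀ ≤ ‖w k‖ ∧ cc (((ω, k), 0), 0) * cc (((ω, k), 0), 1) = w k) ∧
                      (∀ (k : TorusSite 2 L) (k'' : TorusSite 2 L''), latticeMomentum L'' k'' = latticeMomentum L k →
                        cf (((ω, k''), 0), 0) * cf (((ω, k''), 0), 1) = w k) ∧
                      2 * imagTimeWeight β M *
                        ((∑ ybar : TorusSite 2 L,
                            ‖(∑ t₁ : ImagTimeIdx M,
                                sectorisedKernel L M β (trivialMultiplier L M)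
                                    (ExteriorAlgebra.map (LinearMap.mulLeft ℂ cc)
                                      (klEffectiveAction L M β U μ (klFlowFrameU L M β U μ (nScales β + 1)) klE0 (nScales β + 1))) 2
                                    (![((0, 0), 0), ((0, 0), 1)] : Fin 2 → SectorLeg 1) ![oc, (t₁, oc.2 + ybar)] *
                                  Complex.exp (((matsubaraFreq β M ω * (imagTime β M oc.1 - imagTime β M t₁) : ℝ) : ℂ) * I)) -
                              (∑ t₁ : ImagTimeIdx M,
                                sectorisedKernel L'' M β (trivialMultiplier L'' M)
                                    (ExteriorAlgebra.map (LinearMap.mulLeft ℂ cf)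
                                      (klEffectiveAction L'' M β U μ (klFlowFrameU L M β U μ (nScales β + 1)) klE0 (nScales β + 1))) 2
                                    (![((0, 0), 0), ((0, 0), 1)] : Fin 2 → SectorLeg 1) ![of, (t₁, of.2 + Torus.proj L'' (Torus.cRep ybar))] *
                                  Complex.exp (((matsubaraFreq β M ω * (imagTime β M of.1 - imagTime β M t₁) : ℝ) : ℂ) * I))‖) +
                          ∑ y ∈ univ.filter (fun y : TorusSite 2 L'' => Torus.proj L'' (Torus.cRep (fun i => (((y i).val : ℕ) : ZMod L))) ≠ y),
                            ‖∑ t₁ : ImagTimeIdx M,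
                                sectorisedKernel L'' M β (trivialMultiplier L'' M)
                                    (ExteriorAlgebra.map (LinearMap.mulLeft ℂ cf)
                                      (klEffectiveAction L'' M β U μ (klFlowFrameU L M β U μ (nScales β + 1)) klE0 (nScales β + 1))) 2
                                    (![((0, 0), 0), ((0, 0), 1)] : Fin 2 → SectorLeg 1) ![of, (t₁, of.2 + y)] *
                                  Complex.exp (((matsubaraFreq β M ω * (imagTime β M of.1 - imagTime β M t₁) : ℝ) : ℂ) * I)‖) ≤ δ L ∧
                      2 * imagTimeWeight β M * ∑ y : TorusSite 2 L,
                        ‖∑ t₁ : ImagTimeIdx M,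
                            sectorisedKernel L M β (trivialMultiplier L M)
                                (ExteriorAlgebra.map (LinearMap.mulLeft ℂ cc)
                                  (klEffectiveAction L M β U μ (klFlowFrameU L M β U μ (nScales β + 1)) klE0 (nScales β + 1))) 2
                                (![((0, 0), 0), ((0, 0), 1)] : Fin 2 → SectorLeg 1) ![oc, (t₁, oc.2 + y)] *
                              Complex.exp (((matsubaraFreq β M ω * (imagTime β M oc.1 - imagTime β M t₁) : ℝ) : ℂ) * I)‖ ≤ B) :
    Summit.HubbardSuperconductivity.HubbardSuperconductivity.Theses.KLProgramme.KLRegimeVolumeLimitV17F2 :=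
  volumeLimitTextV17F2_of_framedNestedFlowText (framedNestedFlowTextV17F2_of_dressedLastScaleRows hS)

end Summit.HubbardSuperconductivity.HubbardSuperconductivity.Theorems.TwoPointAssembly
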